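import Mathlib.Analysis.InnerProductSpace.PiL2
import HarnessLib

/-!
# No closed ring of five tetrahedra about an edge

Venture `Crystal3D` (cell `pub-crystal3d`, seat p2). The graph `K₂ ∨ C₅` (two touching balls `P, Q` and five balls
`C₀,…,C₄` touching both, consecutive ones touching cyclically) is NOT the contact graph of a packing of equal balls in
`ℝ³`: five regular tetrahedra glued around a common edge leave the angular gap `2π − 5 arccos(1/3) ≈ 7.36°`.
This is the one graph on `7` vertices with `≥ 16` edges that survives the `K₅` and `K_{3,3}` filters, so this lemma is
what makes `C(7) = 15` unconditional (`StickySpheres/ContactSeven.lean`).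

HONEST FRAMING: elementary Euclidean geometry, proved here by linear algebra without angles. With
`w_i := (C_i − P) + (C_i − Q)` and `u := Q − P` (unit diameter, contact = distance `1`): `w_i ⊥ u`, `‖w_i‖² = 3`,
`⟪w_i, w_j⟫ = 3 − 2·dist(C_i, C_j)²` (so `= 1` for touching and `≤ 1` for non-overlapping pairs). Three vectors orthogonal to
`u ≠ 0` in `ℝ³` are linearly dependent; for a consecutive triple the dependence forces `⟪w_{i−1}, w_{i+1}⟫ ∈ {3, −7/3}`, and
non-overlap excludes `3`; then the triple `(w₀, w₁, w₃)` has a non-singular Gram matrix — contradiction. Nothing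
enumerative and nothing about crystallization is claimed here.
-/

noncomputable section

open Real RealInnerProductSpace

namespace Summit.Ventures.Crystal3D

/-- The kernel of the Gram matrix `[[3,1,t],[1,3,1],[t,1,3]]` is trivial unless `t = 3` or `t = -7/3`
(`det = −3 (t − 3)(3t + 7)`). [folklore] -/
theorem gram_ring_step {α β γ t : ℝ} (h1 : 3 * α + β + t * γ = 0) (h2 : α + 3 * β + γ = 0)
    (h3 : t * α + β + 3 * γ = 0) (hne : α ≠ 0 ∨ β ≠ 0 ∨ γ ≠ 0) : t = 3 ∨ t = -7 / 3 := by
  by_contra hcon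
  push Not at hcon
  have hD : (64 - (3 * t - 1) ^ 2) ≠ 0 := by
    have e : 64 - (3 * t - 1) ^ 2 = -3 * ((t - 3) * (3 * t + 7)) := by ring
    rw [e]
    refine mul_ne_zero (by norm_num) (mul_ne_zero (sub_ne_zero.2 hcon.1) ?_)
    intro h
    exact hcon.2 (by linarith)
  have e1 : 8 * α + (3 * t - 1) * γ = 0 := by linear_combination 3 * h1 - h2
  have e3 : (3 * t - 1) * α + 8 * γ = 0 := by linear_combination 3 * h3 - h2
  have ha : (64 - (3 * t - 1) ^ 2) * α = 0 := by linear_combination 8 * e1 - (3 * t - 1) * e3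
  have hc : (64 - (3 * t - 1) ^ 2) * γ = 0 := by linear_combination 8 * e3 - (3 * t - 1) * e1
  have hα : α = 0 := (mul_eq_zero.1 ha).resolve_left hD
  have hγ : γ = 0 := (mul_eq_zero.1 hc).resolve_left hD
  have hβ : β = 0 := by rw [hα, hγ] at h2; linarith
  rcases hne with h | h | h
  · exact h hα
  · exact h hβ
  · exact h hγ

/-- Three vectors of `ℝ³` orthogonal to a non-zero vector admit a non-trivial linear relation. [folklore] -/
theorem exists_rel_of_orthogonal {u a b c : EuclideanSpace ℝ (Fin 3)} (hu : u ≠ 0)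
    (ha : ⟪a, u⟫ = 0) (hb : ⟪b, u⟫ = 0) (hc : ⟪c, u⟫ = 0) :
    ∃ α β γ : ℝ, (α ≠ 0 ∨ β ≠ 0 ∨ γ ≠ 0) ∧ α • a + β • b + γ • c = 0 := by
  have hdep : ¬ LinearIndependent ℝ ![a, b, c, u] := by
    intro hli
    have := hli.fintype_card_le_finrank
    rw [finrank_euclideanSpace_fin, Fintype.card_fin] at this
    omega
  rw [Fintype.not_linearIndependent_iff] at hdep
  obtain ⟨g, hg, i0, hi0⟩ := hdep
  simp only [Fin.sum_univ_four, Matrix.cons_val_zero, Matrix.cons_val_one, Matrix.cons_val] at hg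
  have h3 : g 3 = 0 := by
    have e : ⟪g 0 • a + g 1 • b + g 2 • c + g 3 • u, u⟫ = 0 := by rw [hg, inner_zero_left]
    rw [inner_add_left, inner_add_left, inner_add_left, real_inner_smul_left, real_inner_smul_left,
      real_inner_smul_left, real_inner_smul_left, ha, hb, hc, real_inner_self_eq_norm_sq] at e
    have hun : ‖u‖ ^ 2 ≠ 0 := by positivity
    have : g 3 * ‖u‖ ^ 2 = 0 := by linarith
    exact (mul_eq_zero.1 this).resolve_right hun
  refine ⟨g 0, g 1, g 2, ?_, ?_⟩
  · fin_cases i0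
    · exact Or.inl hi0
    · exact Or.inr (Or.inl hi0)
    · exact Or.inr (Or.inr hi0)
    · exact absurd h3 hi0
  · rw [h3, zero_smul, add_zero] at hg
    exact hg

/-- Inner products of a linear relation with a test vector. [folklore] -/
theorem inner_rel_eq_zero {a b c v : EuclideanSpace ℝ (Fin 3)} {α β γ : ℝ}
    (h : α • a + β • b + γ • c = 0) : α * ⟪a, v⟫ + β * ⟪b, v⟫ + γ * ⟪c, v⟫ = 0 := by
  have e : ⟪α • a + β • b + γ • c, v⟫ = 0 := by rw [h, inner_zero_left]
  rwa [inner_add_left, inner_add_left, real_inner_smul_left, real_inner_smul_left,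
    real_inner_smul_left] at e

/-- **No closed ring of five tetrahedra about an edge** (`K₂ ∨ C₅` is not a contact subgraph). If `dist P Q = 1`, the
five points `C i` are at distance `1` from `P` and from `Q`, consecutive ones (cyclically) at distance `1`, and
`dist (C 1) (C 3) ≥ 1`, `dist (C 0) (C 3) ≥ 1`, we reach a contradiction. [folklore] -/
theorem no_five_ring (P Q : EuclideanSpace ℝ (Fin 3)) (C : Fin 5 → EuclideanSpace ℝ (Fin 3))
    (hPQ : dist P Q = 1) (hP : ∀ i, dist (C i) P = 1) (hQ : ∀ i, dist (C i) Q = 1)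
    (h01 : dist (C 0) (C 1) = 1) (h12 : dist (C 1) (C 2) = 1) (h23 : dist (C 2) (C 3) = 1)
    (h34 : dist (C 3) (C 4) = 1) (h40 : dist (C 4) (C 0) = 1)
    (h13 : 1 ≤ dist (C 1) (C 3)) (h03 : 1 ≤ dist (C 0) (C 3)) : False := by
  obtain ⟨u, hudef⟩ : ∃ u : EuclideanSpace ℝ (Fin 3), u = Q - P := ⟨_, rfl⟩
  obtain ⟨w, hwdef⟩ : ∃ w : Fin 5 → EuclideanSpace ℝ (Fin 3), ∀ i, w i = (C i - P) + (C i - Q) :=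
    ⟨_, fun i => rfl⟩
  have hu : u ≠ 0 := by
    rw [hudef, sub_ne_zero]
    intro h
    rw [h, dist_self] at hPQ
    exact zero_ne_one hPQ
  -- w i ⊥ u
  have hwu : ∀ i, ⟪w i, u⟫ = 0 := by
    intro i
    have e : u = (C i - P) - (C i - Q) := by rw [hudef]; abel
    rw [hwdef, e, inner_sub_right, inner_add_left, inner_add_left, real_inner_comm (C i - P) (C i - Q),
      real_inner_self_eq_norm_sq, real_inner_self_eq_norm_sq, ← dist_eq_norm, ← dist_eq_norm, hP i, hQ i]
    ring
  -- ‖w i‖² = 3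
  have hww : ∀ i, ⟪w i, w i⟫ = 3 := by
    intro i
    have e1 := norm_add_sq_real (C i - P) (C i - Q)
    have e2 := norm_sub_sq_real (C i - P) (C i - Q)
    have e3 : (C i - P) - (C i - Q) = Q - P := by abel
    rw [e3, ← dist_eq_norm, dist_comm, hPQ] at e2
    rw [← dist_eq_norm, ← dist_eq_norm, hP i, hQ i] at e1 e2
    rw [hwdef, real_inner_self_eq_norm_sq]
    linarith
  -- ⟪w i, w j⟫ = 3 − 2 dist²
  have hwij : ∀ i j, ⟪w i, w j⟫ = 3 - 2 * dist (C i) (C j) ^ 2 := by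
    intro i j
    have e1 := norm_sub_sq_real (w i) (w j)
    have e2 : w i - w j = (2 : ℝ) • (C i - C j) := by rw [hwdef, hwdef, two_smul]; abel
    rw [e2, norm_smul, Real.norm_eq_abs, abs_of_pos (by norm_num : (0 : ℝ) < 2), ← dist_eq_norm, mul_pow,
      ← real_inner_self_eq_norm_sq, ← real_inner_self_eq_norm_sq, hww, hww] at e1
    linarith
  have hc : ∀ i j, dist (C i) (C j) = 1 → ⟪w i, w j⟫ = 1 := fun i j h => by rw [hwij, h]; norm_num
  have hle : ∀ i j, 1 ≤ dist (C i) (C j) → ⟪w i, w j⟫ ≤ 1 := fun i j h => by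
    rw [hwij]; nlinarith
  have c01 := hc 0 1 h01
  have c12 := hc 1 2 h12
  have c23 := hc 2 3 h23
  have c34 := hc 3 4 h34
  have c40 := hc 4 0 h40
  have c10 : ⟪w 1, w 0⟫ = 1 := by rw [real_inner_comm]; exact c01
  have c21 : ⟪w 2, w 1⟫ = 1 := by rw [real_inner_comm]; exact c12
  have c32 : ⟪w 3, w 2⟫ = 1 := by rw [real_inner_comm]; exact c23
  have c43 : ⟪w 4, w 3⟫ = 1 := by rw [real_inner_comm]; exact c34
  have c04 : ⟪w 0, w 4⟫ = 1 := by rw [real_inner_comm]; exact c40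
  -- step 1: the consecutive triple (w 1, w 2, w 3) forces ⟪w 1, w 3⟫ = -7/3
  have t13 : ⟪w 1, w 3⟫ = -7 / 3 := by
    obtain ⟨α, β, γ, hne, hrel⟩ := exists_rel_of_orthogonal hu (hwu 1) (hwu 2) (hwu 3)
    have e1 := inner_rel_eq_zero (v := w 1) hrel
    have e2 := inner_rel_eq_zero (v := w 2) hrel
    have e3 := inner_rel_eq_zero (v := w 3) hrel
    rw [hww, c21, real_inner_comm (w 1) (w 3)] at e1
    rw [c12, hww, c32] at e2
    rw [c23, hww] at e3
    have h := gram_ring_step (t := ⟪w 1, w 3⟫) (by linarith) (by linarith) (by linarith) hne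
    rcases h with h | h
    · linarith [hle 1 3 h13]
    · exact h
  -- step 2: the consecutive triple (w 3, w 4, w 0) forces ⟪w 3, w 0⟫ = -7/3
  have t30 : ⟪w 3, w 0⟫ = -7 / 3 := by
    obtain ⟨α, β, γ, hne, hrel⟩ := exists_rel_of_orthogonal hu (hwu 3) (hwu 4) (hwu 0)
    have e1 := inner_rel_eq_zero (v := w 3) hrel
    have e2 := inner_rel_eq_zero (v := w 4) hrel
    have e3 := inner_rel_eq_zero (v := w 0) hrel
    rw [hww, c43, real_inner_comm (w 3) (w 0)] at e1
    rw [c34, hww, c04] at e2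
    rw [c40, hww] at e3
    have h30 : 1 ≤ dist (C 3) (C 0) := by rw [dist_comm]; exact h03
    have h := gram_ring_step (t := ⟪w 3, w 0⟫) (by linarith) (by linarith) (by linarith) hne
    rcases h with h | h
    · linarith [hle 3 0 h30]
    · exact h
  -- step 3: the triple (w 0, w 1, w 3) has a non-singular Gram matrix
  obtain ⟨α, β, γ, hne, hrel⟩ := exists_rel_of_orthogonal hu (hwu 0) (hwu 1) (hwu 3)
  have e1 := inner_rel_eq_zero (v := w 0) hrel
  have e2 := inner_rel_eq_zero (v := w 1) hrel
  have e3 := inner_rel_eq_zero (v := w 3) hrel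
  rw [hww, c10, t30] at e1
  rw [c01, hww, real_inner_comm (w 1) (w 3), t13] at e2
  have t03 : ⟪w 0, w 3⟫ = -7 / 3 := by rw [real_inner_comm]; exact t30
  rw [t03, t13, hww] at e3
  have hα : α = 0 := by linarith
  have hβ : β = 0 := by linarith
  have hγ : γ = 0 := by linarith
  rcases hne with h | h | h
  · exact h hα
  · exact h hβ
  · exact h hγ

end Summit.Ventures.Crystal3D

end
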